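import Literature.NumberTheory.QuadraticFields.EffectiveClassNumberLowerBoundProofs
import HarnessLib

/-!
# Oesterlé 1988, §9: the class-number tables `h(−d) = 3, 4, 5, 6 ⇒ log d ≤ …` (PROVED from the
# explicit form of Oesterlé 1985, Théorème 1)

Topic `NumberTheory/QuadraticFields`; proof companion of `EffectiveClassNumberLowerBound.lean`
and `EffectiveClassNumberLowerBoundProofs.lean` (seat `rh-explicit-goldfeld-lit`, GOLDFELD track of
the `rh-explicit` cell; source read AS PRINTED in HOME `goldfeld/GOLDFELD-LIT.md` §9, page scans
`goldfeld/lit-scans/oesterle1988-p66.jpg`, `-p67.jpg`). Everything here is PROVED (theorems only,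
no named fact introduced); the only hypothesis is the tree's named fact
`Oesterle1985_theoreme1_explicit` (`θ(d) log d ≤ 7000 · h(−d)` for every imaginary quadratic
field, and `≤ 55 · h(−d)` when `(d, 5077) = 1`).

**Oesterlé 1988** [Oesterle1988Gauss], *Le problème de Gauss sur le nombre de classes*, Enseign.
Math. (2) 34 (1988) 43–67, §9 «Conclusion», p. 66: "Gross et Zagier ont vérifié que la courbe
elliptique d'équation (minimale) `y² + y = x³ − x² − 450823x + 112971139` satisfait aux exigences
du §6. En calculant la constante `c_E` correspondante (cf. pour cela mon exposé au Séminaire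
Bourbaki), on obtient
  `h(−d) = 3 ⇒ log d ≤ 21000`,  `h(−d) = 4 ⇒ log d ≤ 336000`,
  `h(−d) = 5 ⇒ log d ≤ 35000`,  `h(−d) = 6 ⇒ log d ≤ 168000`  etc."
and p. 67: "D'autres courbes elliptiques de Weil `E` telles que `E(Q)` soit de rang 3, trouvées par
Mestre, `y² + y = x³ − 7x + 6` (`N_E = 5077`), `y² + y = x³ − x + 6` (`N_E = 16811`),
`y² + y = x³ − 19x + 30` (`N_E = 43669`), permettent d'obtenir de meilleures majorations:
  `h(−d) = 3 ⇒ log d ≤ 165`,  `h(−d) = 4 ⇒ log d ≤ 2640`,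
  `h(−d) = 5 ⇒ log d ≤ 275`,  `h(−d) = 6 ⇒ log d ≤ 1320`  etc."

These eight numbers are EXACTLY Oesterlé 1985, Théorème 1 with `C = 7000`, resp. `C = 55`, fed
through the genus-theory corollaries of p. 311 (`h` odd `⇒ log d ≤ C h`; `h ≡ 2 (mod 4) ⇒ ≤ 4 C h`;
`h ≡ 4 (mod 8) ⇒ ≤ 12 C h`): `3·C`, `12·4·C = 48 C`, `5·C`, `4·6·C = 24 C`. We prove them in that
form. The `C = 55` table is stated, as the tree fact is, under `(d, 5077) = 1` — the hypothesis
printed in Oesterlé 1985 §5.1 ("à condition de se restreindre aux discriminants `d` premiers à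
`5077`"); the 1988 text obtains the unrestricted table by using the three curves of (prime)
conductor `5077`, `16811`, `43669` together, a step whose constants for the last two curves are not
printed, so it is NOT asserted here.

## Contents

* `log_le_of_theta_log_le` — the p. 311 corollaries for ONE field and an ARBITRARY constant `C`:
  from `θ(d) log d ≤ C h` we get `h` odd `⇒ log d ≤ C h` and, for every `k`,
  `2^{k+1} ∤ h ⇒ log d ≤ (4/3)·3^k·C·h` (the per-field core of `log_le_of_oesterle` /
  `log_le_of_oesterle_two_adic`, which quantify the constant existentially).
* `Oesterle1985_theoreme1_explicit.classNumber_tables` — the two printed tables (eight lines).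
* `Oesterle1985_theoreme1_explicit.log_le_of_classNumber_eq_three` — the line used for the class
  number three problem: `h(−d) = 3 ⇒ log d ≤ 21000`, and `≤ 165` if `(d, 5077) = 1`.

## References

* [Oesterle1988Gauss] J. Oesterlé, Enseign. Math. (2) 34 (1988) 43–67, §9, pp. 66–67 (the tables),
  doi 10.5169/seals-56588.
* [Oesterle1985] J. Oesterlé, Sém. Bourbaki exp. 631, Astérisque 121–122 (1985), Thm. 1 (p. 310),
  p. 311 (corollaries), §5.1 (p. 321: `C = 7000`, `C = 55`).
-/

noncomputable section

open scoped Classical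

open Real Finset NumberField Module

namespace Literature.NumberTheory.QuadraticFields

/-- **Oesterlé 1985, p. 311, for one field and an arbitrary constant.** If `K` is an imaginary
quadratic field (`finrank ℚ K = 2`, `d_K < 0`), `d = |d_K|`, `h = h_K`, and `θ(d) log d ≤ C h`, then
(i) `h` odd `⇒ log d ≤ C h` (genus theory: `2^{t−1} ∣ h`, so `t ≤ 1` and `θ(d) = 1`), and
(ii) for every `k`, `2^{k+1} ∤ h ⇒ log d ≤ (4/3)·3^k·C·h` (`t − 1 ≤ k` and `θ(d) ≥ (3/4)·3^{−(t−1)}`).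
[cite: Oesterle1985, p. 311] -/
theorem log_le_of_theta_log_le {K : Type*} [Field K] [NumberField K]
    (h2 : Module.finrank ℚ K = 2) (hd : NumberField.discr K < 0) {C : ℝ}
    (hOeK : oesterleTheta (NumberField.discr K).natAbs *
        Real.log ((NumberField.discr K).natAbs : ℝ) ≤ C * (NumberField.classNumber K : ℝ)) :
    (Odd (NumberField.classNumber K) →
        Real.log ((NumberField.discr K).natAbs : ℝ) ≤ C * (NumberField.classNumber K : ℝ)) ∧
      ∀ k : ℕ, ¬ 2 ^ (k + 1) ∣ NumberField.classNumber K →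
        Real.log ((NumberField.discr K).natAbs : ℝ) ≤
          4 / 3 * 3 ^ k * C * (NumberField.classNumber K : ℝ) := by
  have hIQ : Literature.NumberTheory.EllipticCurves.IsImaginaryQuadratic K :=
    Literature.NumberTheory.EllipticCurves.isImaginaryQuadratic_iff_discr_neg.mpr ⟨h2, hd⟩
  have hgen := two_pow_dvd_classNumber hIQ
  set d : ℕ := (NumberField.discr K).natAbs with hdd
  have hL0 : 0 ≤ Real.log (d : ℝ) := Real.log_natCast_nonneg d
  constructor
  · -- `h` odd ⇒ `t ≤ 1` ⇒ `θ(d) = 1`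
    intro hodd
    have ht : d.primeFactors.card ≤ 1 := by
      by_contra hlt
      have h2dvd : 2 ∣ 2 ^ (d.primeFactors.card - 1) := dvd_pow_self 2 (by omega)
      exact (Nat.not_even_iff_odd.mpr hodd) (even_iff_two_dvd.mpr (h2dvd.trans hgen))
    have hθ : oesterleTheta d = 1 := oesterleTheta_of_card_primeFactors_le_one ht
    rw [hθ, one_mul] at hOeK
    exact hOeK
  · intro k hk
    -- `t − 1 ≤ k`
    have ht : d.primeFactors.card - 1 ≤ k := by
      by_contra hlt
      exact hk ((Nat.pow_dvd_pow 2 (by omega)).trans hgen)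
    have hθ : 3 / 4 * (1 / 3 : ℝ) ^ k ≤ oesterleTheta d :=
      le_trans (mul_le_mul_of_nonneg_left (pow_le_pow_of_le_one (by norm_num) (by norm_num) ht)
        (by norm_num)) (oesterleTheta_ge_two_adic d)
    have hle : 3 / 4 * (1 / 3 : ℝ) ^ k * Real.log (d : ℝ) ≤ C * (NumberField.classNumber K : ℝ) :=
      le_trans (mul_le_mul_of_nonneg_right hθ hL0) hOeK
    have e : (4 : ℝ) / 3 * 3 ^ k * (3 / 4 * (1 / 3) ^ k * Real.log (d : ℝ)) = Real.log (d : ℝ) := by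
      rw [one_div_pow]; field_simp
    calc Real.log (d : ℝ) = 4 / 3 * 3 ^ k * (3 / 4 * (1 / 3) ^ k * Real.log (d : ℝ)) := e.symm
      _ ≤ 4 / 3 * 3 ^ k * (C * (NumberField.classNumber K : ℝ)) := by gcongr
      _ = 4 / 3 * 3 ^ k * C * (NumberField.classNumber K : ℝ) := by ring

/-- The four printed lines for one field and an arbitrary constant `C` with `θ(d) log d ≤ C h`:
`h = 3 ⇒ log d ≤ 3 C`, `h = 4 ⇒ log d ≤ 48 C`, `h = 5 ⇒ log d ≤ 5 C`, `h = 6 ⇒ log d ≤ 24 C`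
(`h = 3, 5` odd; `h = 4`: `8 ∤ 4`, `(4/3)·9·4 = 48`; `h = 6`: `4 ∤ 6`, `(4/3)·3·6 = 24`).
[cite: Oesterle1985, p. 311] [cite: Oesterle1988Gauss, §9 (pp. 66–67)] -/
theorem log_le_table_of_theta_log_le {K : Type*} [Field K] [NumberField K]
    (h2 : Module.finrank ℚ K = 2) (hd : NumberField.discr K < 0) {C : ℝ}
    (hOeK : oesterleTheta (NumberField.discr K).natAbs *
        Real.log ((NumberField.discr K).natAbs : ℝ) ≤ C * (NumberField.classNumber K : ℝ)) :
    (NumberField.classNumber K = 3 → Real.log ((NumberField.discr K).natAbs : ℝ) ≤ 3 * C) ∧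
    (NumberField.classNumber K = 4 → Real.log ((NumberField.discr K).natAbs : ℝ) ≤ 48 * C) ∧
    (NumberField.classNumber K = 5 → Real.log ((NumberField.discr K).natAbs : ℝ) ≤ 5 * C) ∧
    (NumberField.classNumber K = 6 → Real.log ((NumberField.discr K).natAbs : ℝ) ≤ 24 * C) := by
  obtain ⟨hodd, hk⟩ := log_le_of_theta_log_le h2 hd hOeK
  refine ⟨fun h3 => ?_, fun h4 => ?_, fun h5 => ?_, fun h6 => ?_⟩
  · have := hodd (by rw [h3]; decide)
    rw [h3] at this; push_cast at this; linarith
  · have h8 : ¬ 2 ^ (2 + 1) ∣ NumberField.classNumber K := by rw [h4]; decide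
    have := hk 2 h8
    rw [h4] at this; push_cast at this; linarith
  · have := hodd (by rw [h5]; decide)
    rw [h5] at this; push_cast at this; linarith
  · have h4' : ¬ 2 ^ (1 + 1) ∣ NumberField.classNumber K := by rw [h6]; decide
    have := hk 1 h4'
    rw [h6] at this; push_cast at this; linarith

/-- **Oesterlé 1988, §9 (pp. 66–67), the two class-number tables, PROVED from the explicit form
of Oesterlé 1985, Théorème 1.** For every imaginary quadratic field `K` (`finrank ℚ K = 2`,
`d_K < 0`), with `d = |d_K|` and `h = h_K`:
`h = 3 ⇒ log d ≤ 21000`, `h = 4 ⇒ log d ≤ 336000`, `h = 5 ⇒ log d ≤ 35000`, `h = 6 ⇒ log d ≤ 168000`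
(the curve of conductor `37·139²`, `C = 7000`), and, when `(d, 5077) = 1`,
`h = 3 ⇒ log d ≤ 165`, `h = 4 ⇒ log d ≤ 2640`, `h = 5 ⇒ log d ≤ 275`, `h = 6 ⇒ log d ≤ 1320`
(`C = 55`; printed for Mestre's curves of conductor `5077`, `16811`, `43669`, here under the
coprimality clause of the tree fact — see the module docstring). Hypothesis: the named fact
`Oesterle1985_theoreme1_explicit`. [cite: Oesterle1988Gauss, §9 (pp. 66–67)]
[cite: Oesterle1985, §5.1 (p. 321), p. 311] -/
theorem Oesterle1985_theoreme1_explicit.classNumber_tables (h : Oesterle1985_theoreme1_explicit)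
    (K : Type) [Field K] [NumberField K]
    (h2 : Module.finrank ℚ K = 2) (hd : NumberField.discr K < 0) :
    ((NumberField.classNumber K = 3 → Real.log ((NumberField.discr K).natAbs : ℝ) ≤ 21000) ∧
      (NumberField.classNumber K = 4 → Real.log ((NumberField.discr K).natAbs : ℝ) ≤ 336000) ∧
      (NumberField.classNumber K = 5 → Real.log ((NumberField.discr K).natAbs : ℝ) ≤ 35000) ∧
      (NumberField.classNumber K = 6 → Real.log ((NumberField.discr K).natAbs : ℝ) ≤ 168000)) ∧
    (Nat.Coprime (NumberField.discr K).natAbs 5077 →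
      (NumberField.classNumber K = 3 → Real.log ((NumberField.discr K).natAbs : ℝ) ≤ 165) ∧
      (NumberField.classNumber K = 4 → Real.log ((NumberField.discr K).natAbs : ℝ) ≤ 2640) ∧
      (NumberField.classNumber K = 5 → Real.log ((NumberField.discr K).natAbs : ℝ) ≤ 275) ∧
      (NumberField.classNumber K = 6 → Real.log ((NumberField.discr K).natAbs : ℝ) ≤ 1320)) := by
  obtain ⟨h7000, h55⟩ := h K h2 hd
  constructor
  · obtain ⟨a, b, c, e⟩ := log_le_table_of_theta_log_le h2 hd h7000
    exact ⟨fun h3 => by linarith [a h3], fun h4 => by linarith [b h4],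
      fun h5 => by linarith [c h5], fun h6 => by linarith [e h6]⟩
  · intro hcop
    obtain ⟨a, b, c, e⟩ := log_le_table_of_theta_log_le h2 hd (h55 hcop)
    exact ⟨fun h3 => by linarith [a h3], fun h4 => by linarith [b h4],
      fun h5 => by linarith [c h5], fun h6 => by linarith [e h6]⟩

/-- **The class-number-three line** (Oesterlé 1988, p. 66 and p. 67; with Montgomery–Weinberger
1973 it completes the list of imaginary quadratic fields of class number `3`, ibid. p. 67 and
Goldfeld 1985, p. 33): `h(−d) = 3 ⇒ log d ≤ 21000`, and `log d ≤ 165` if `(d, 5077) = 1` (for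
`h` odd, `d` is a prime power, so the clause only excludes `d = 5077`, Oesterlé 1985 §5.1:
"restriction sans importance si l'on suppose `h(−d)` impair").
[cite: Oesterle1988Gauss, §9 (pp. 66–67)] [cite: Oesterle1985, §5.1 (p. 321)] -/
theorem Oesterle1985_theoreme1_explicit.log_le_of_classNumber_eq_three
    (h : Oesterle1985_theoreme1_explicit) (K : Type) [Field K] [NumberField K]
    (h2 : Module.finrank ℚ K = 2) (hd : NumberField.discr K < 0)
    (h3 : NumberField.classNumber K = 3) :
    Real.log ((NumberField.discr K).natAbs : ℝ) ≤ 21000 ∧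
      (Nat.Coprime (NumberField.discr K).natAbs 5077 →
        Real.log ((NumberField.discr K).natAbs : ℝ) ≤ 165) := by
  obtain ⟨hA, hB⟩ := Oesterle1985_theoreme1_explicit.classNumber_tables h K h2 hd
  exact ⟨hA.1 h3, fun hcop => (hB hcop).1 h3⟩

end Literature.NumberTheory.QuadraticFields

end
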